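import Literature.FieldTheory.FunctionField.RationalCartierOperator
import Literature.Algebra.Polynomial.CartierOperatorIteratedDerivative
import HarnessLib

/-!
# `(𝒞 y)^p = −D^{p−1} y` on `k(x)`, Theorem 4 as differential equations on the rational function field, and
# the identity `(Dz/z)^p + D^{p−1}(Dz/z) = 0` for logarithmic derivatives

Topic `Literature/FieldTheory/FunctionField`; namespace `Literature.FieldTheory.FunctionField`.  Lane
`lit-hodgefound` (Track 2 foundations library), seat p01 gen 20, row g20-#10 FILE B.  THEOREMS ONLY (no
definition, no named fact, no instance, no notation; D-0014/D-0026, net Literature debt 0).  Sequel BY IMPORT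
of `RationalCartierOperator.lean` (g20-#5: `ratFuncCartier p` on `RatFunc k`, C2/C3, Theorem 4 (i)) and of
`Algebra/Polynomial/CartierOperatorIteratedDerivative.lean` (g20-#10 FILE A: `f^{(p−1)} = −(U f)(x^p)` on
`k[x]`) — REUSED, nothing restated; `D` is any `Derivation k (RatFunc k) (RatFunc k)` with `D P = P′` on
`k[x]` (the tree's `HermiteReduction` convention).

## Source

S. Lang, *Elliptic Functions* [Lang1987], Appendix 1 §3 (p0225: `S_x`, `D_x`, «`y = D_x z` … if and only
if `y_{p−1} = 0`», S2 «`S_x(D_x y/y) = (D_x y/y)^p`») and §4 (p0226–p0227: «`C(y dx) = S_x(y)^{1/p} dx`»,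
C3, Theorem 4).  With `S_x = −D_x^{p−1}` (FILE A) these read as the statements below; in particular S2 is
literally the identity `(D_x y/y)^p + D_x^{p−1}(D_x y/y) = 0`.

## What is proved (`k` perfect of characteristic `p`)

* `iterate_deriv_algebraMap_div_pow` — `D^{n}(F/Q^p) = F^{(n)}/Q^p` (`Q^p` is a `D`-constant);
* **`ratFuncCartier_pow_eq_neg_iterate_deriv`** — `(𝒞 y)^p = −D^{p−1} y` for every `y ∈ k(x)`
  (`𝒞(y dx) = (−D^{p−1}y)^{1/p} dx`);
* **Theorem 4 (i) as an ODE**: `exists_deriv_eq_iff_iterate_deriv` — `(∃ z, Dz = y) ⟺ D^{p−1} y = 0`; and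
  `iterate_deriv_prime_eq_zero` — `D^p = 0` on `k(x)`;
* **Theorem 4 (ii)'s condition as an ODE**: `ratFuncCartier_eq_self_iff_iterate_deriv` —
  `𝒞(y dx) = y dx ⟺ y^p + D^{p−1} y = 0`;
* **S2 / the logarithmic-derivative identity**: `logDeriv_pow_add_iterate_deriv` — `(Dz/z)^p + D^{p−1}(Dz/z) = 0`
  for every `z ≠ 0` in `k(x)` (from C3 `𝒞(dz/z) = dz/z` of g20-#5 and the formula).

## Honest scope

`k(x)` only; the converse «every solution of `y^p + D^{p−1}y = 0` in `k̄(x)` is a logarithmic derivative»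
(Theorem 4 (ii) ⟹) is not proved.
-/

noncomputable section

open Polynomial Literature.Algebra.Polynomial

namespace Literature.FieldTheory.FunctionField

variable {K : Type*} [Field K] (p : ℕ) [Fact p.Prime] [CharP K p] [PerfectRing K p]
variable (D : Derivation K (RatFunc K) (RatFunc K))
  (hD : ∀ P : K[X], D (algebraMap K[X] (RatFunc K) P) = algebraMap K[X] (RatFunc K) (derivative P))

include hD

omit [PerfectRing K p] in
/-- `D(F/Q^p) = F′/Q^p`: `Q^p` is a `D`-constant in characteristic `p`. [cite: Lang1987, Appendix 1 §3] -/
theorem deriv_algebraMap_div_pow (F Q : K[X]) :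
    D (algebraMap K[X] (RatFunc K) F / algebraMap K[X] (RatFunc K) (Q ^ p)) =
      algebraMap K[X] (RatFunc K) (derivative F) / algebraMap K[X] (RatFunc K) (Q ^ p) := by
  by_cases hQ : Q = 0
  · have hp : p ≠ 0 := (Fact.out : p.Prime).ne_zero
    rw [hQ, zero_pow hp, map_zero, div_zero, div_zero, map_zero]
  have hQ' : algebraMap K[X] (RatFunc K) (Q ^ p) ≠ 0 :=
    (map_ne_zero_iff _ (RatFunc.algebraMap_injective K)).mpr (pow_ne_zero _ hQ)
  rw [HermiteReduction.usualDerivative_div D hD, derivative_pow, CharP.cast_eq_zero K p, map_zero, zero_mul,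
    zero_mul, map_zero, mul_zero, sub_zero]
  field_simp

omit [PerfectRing K p] in
/-- `Dⁿ(F/Q^p) = F^{(n)}/Q^p`. [cite: Lang1987, Appendix 1 §3] -/
theorem iterate_deriv_algebraMap_div_pow (F Q : K[X]) (n : ℕ) :
    (D : RatFunc K → RatFunc K)^[n] (algebraMap K[X] (RatFunc K) F / algebraMap K[X] (RatFunc K) (Q ^ p)) =
      algebraMap K[X] (RatFunc K) (derivative^[n] F) / algebraMap K[X] (RatFunc K) (Q ^ p) := by
  induction n generalizing F with
  | zero => rfl
  | succ n ih =>
    rw [Function.iterate_succ_apply, Function.iterate_succ_apply, deriv_algebraMap_div_pow p D hD, ih]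

/-- **`(𝒞 y)^p = −D^{p−1} y` for every `y ∈ k(x)`** — `𝒞(y dx) = (−D^{p−1} y)^{1/p} dx`
(«`C(y dx) = S_x(y)^{1/p} dx`» with `S_x = −D_x^{p−1}`; for `y = P/Q = P Q^{p−1}/Q^p` it is FILE A applied to
`P Q^{p−1}`). [cite: Lang1987, Appendix 1 §3, §4] -/
theorem ratFuncCartier_pow_eq_neg_iterate_deriv (y : RatFunc K) :
    ratFuncCartier p y ^ p = -((D : RatFunc K → RatFunc K)^[p - 1] y) := by
  have hp : p ≠ 0 := (Fact.out : p.Prime).ne_zero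
  induction y using RatFunc.induction_on with
  | f P Q hQ =>
    have hQ' : algebraMap K[X] (RatFunc K) Q ≠ 0 :=
      (map_ne_zero_iff _ (RatFunc.algebraMap_injective K)).mpr hQ
    have hy : algebraMap K[X] (RatFunc K) P / algebraMap K[X] (RatFunc K) Q =
        algebraMap K[X] (RatFunc K) (P * Q ^ (p - 1)) / algebraMap K[X] (RatFunc K) (Q ^ p) := by
      rw [map_mul, map_pow, map_pow, ← pow_sub_one_mul hp (algebraMap K[X] (RatFunc K) Q)]
      field_simp
    rw [ratFuncCartier_div, hy, iterate_deriv_algebraMap_div_pow p D hD,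
      iterate_derivative_eq_neg_expand_cartierTwist, ← cartier_pow_eq_expand_cartierTwist, map_neg, map_pow,
      map_pow, neg_div, neg_neg, div_pow]

/-- **Theorem 4 (i) on `k(x)` as a differential equation**: `y = Dz` for some `z ∈ k(x)` iff `D^{p−1} y = 0`.
[cite: Lang1987, Appendix 1 §3, §4 Thm. 4 (i)] -/
theorem exists_deriv_eq_iff_iterate_deriv (y : RatFunc K) :
    (∃ z : RatFunc K, D z = y) ↔ (D : RatFunc K → RatFunc K)^[p - 1] y = 0 := by
  rw [← ratFuncCartier_eq_zero_iff p D hD, ← pow_eq_zero_iff (Fact.out : p.Prime).ne_zero,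
    ratFuncCartier_pow_eq_neg_iterate_deriv p D hD, neg_eq_zero]

/-- Hence **`D^p = 0` on `k(x)`**. [cite: Lang1987, Appendix 1 §3] -/
theorem iterate_deriv_prime_eq_zero (z : RatFunc K) : (D : RatFunc K → RatFunc K)^[p] z = 0 := by
  have hp : p = (p - 1) + 1 := (Nat.sub_add_cancel (Fact.out : p.Prime).one_lt.le).symm
  rw [hp, Function.iterate_succ_apply, ← exists_deriv_eq_iff_iterate_deriv p D hD]
  exact ⟨z, rfl⟩

/-- **Theorem 4 (ii)'s condition on `k(x)` as a differential equation**: `𝒞(y dx) = y dx ⟺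
y^p + D^{p−1} y = 0`. [cite: Lang1987, Appendix 1 §4 Thm. 4 (ii)] -/
theorem ratFuncCartier_eq_self_iff_iterate_deriv (y : RatFunc K) :
    ratFuncCartier p y = y ↔ y ^ p + (D : RatFunc K → RatFunc K)^[p - 1] y = 0 := by
  rw [← sub_neg_eq_add, sub_eq_zero, ← ratFuncCartier_pow_eq_neg_iterate_deriv p D hD]
  constructor
  · intro h
    rw [h]
  · intro h
    exact (frobenius_inj (RatFunc K) p h).symm

/-- **S2 / the identity of the logarithmic derivative**: `(Dz/z)^p + D^{p−1}(Dz/z) = 0` for every `z ≠ 0`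
in `k(x)` («**S2.** `S_x(D_x y/y) = (D_x y/y)^p`», with `S_x = −D_x^{p−1}`; equivalently C3
`𝒞(dz/z) = dz/z` through the formula). [cite: Lang1987, Appendix 1 §3 S2, §4 C3] -/
theorem logDeriv_pow_add_iterate_deriv {z : RatFunc K} (hz : z ≠ 0) :
    (D z / z) ^ p + (D : RatFunc K → RatFunc K)^[p - 1] (D z / z) = 0 :=
  (ratFuncCartier_eq_self_iff_iterate_deriv p D hD _).mp (ratFuncCartier_deriv_div_self p D hD hz)

end Literature.FieldTheory.FunctionField
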